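import Summits.QuantumFields.GaugeBoot.DiagonalRPTorusReplicaTransport
import HarnessLib

/-!
# The leading jet of a replica cluster integral (gauge-boot, L3 `d = 3` uniform window, J2 brick 4)

HONEST FRAMING (cell `pub-gaugeboot`, page 1 of every file): the venture produces certified bounds
on lattice expectations at stated coupling, gauge group, dimension and torus size; NOT a mass gap,
NOT a continuum limit, NOT a string tension; NOT Yang–Mills-summit-bearing (barriers
`FixedCouplingUltralocality`, `PerturbativeInvisibility`). This module is bookkeeping for a
structural NEGATIVE result (a coupling window UNIFORM in the torus size for the failure of
inner-half diagonal reflection positivity on `(ℤ/L)^3`, plan note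
`HOME/pub-gaugeboot-lean3/gen46/D3-UNIFORM-PLAN.md` §3 item 6c (J2)); it discharges nothing by
itself.

## Content (torus `(ℤ/L)^d`, compact metrisable `G`, continuous `ρ`, any `d`)

* `cost ρ q V = N - Re tr ρ(V_q)` and `tdweight z q (V,V') = e^{-z (cost V + cost V')} - 1`
  (`tdweight_eq_exp`); `|cost| ≤ 2N`.
* `norm_prod_add_sub_prod_le` — the finite-product perturbation bound
  `‖∏ (a_i + b_i) - ∏ a_i‖ ≤ n δ (α + δ)^{n-1}` for `‖a_i‖ ≤ α`, `‖b_i‖ ≤ δ`.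
* `jetCoeff ρ f g Q = ∫ (f V - f V')(g V - g V') ∏_{q ∈ Q} (-(cost_q V + cost_q V')) d(π ⊗ π)`
  and ★★ **`replicaTerm_jet`**:
  `replicaTerm f g Q z - jetCoeff · z^{#Q} = O(z^{#Q + 1})` at `z = 0`
  (each doubled weight is `-z σ_q + O(z²)` uniformly on the compact configuration space).

So the order-`#Q` jet of a replica cluster integral is ONE real product-Haar moment; its
evaluation for the annulus of the `d = 3` leg (`= 2 E[f g ∏ Re χ(U_q)]` by lonely links, then
`c₁^{11} N` by gluing) is brick 5. Elementary; no named fact.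
-/

open MeasureTheory Finset Function Filter Asymptotics
open scoped Topology

namespace Summit.QuantumFields.GaugeBoot

open Literature.MathematicalPhysics.QuantumFieldTheory

noncomputable section

namespace DiagRPUnif

open DiagRPTube

/-! ## A finite-product perturbation bound -/

/-- ‖∏ (a_i + b_i) - ∏ a_i‖ ≤ n · δ · (α + δ)^{n-1}` for `‖a_i‖ ≤ α`, `‖b_i‖ ≤ δ`. -/
theorem norm_prod_add_sub_prod_le {ι : Type*} [DecidableEq ι] (s : Finset ι) {a b : ι → ℂ}
    {α δ : ℝ} (hα : 0 ≤ α) (hδ : 0 ≤ δ) (ha : ∀ i ∈ s, ‖a i‖ ≤ α) (hb : ∀ i ∈ s, ‖b i‖ ≤ δ) :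
    ‖∏ i ∈ s, (a i + b i) - ∏ i ∈ s, a i‖ ≤ s.card * δ * (α + δ) ^ (s.card - 1) := by
  induction s using Finset.induction_on with
  | empty => simp
  | insert i s hi ih =>
    have ha' : ∀ j ∈ s, ‖a j‖ ≤ α := fun j hj => ha j (mem_insert_of_mem hj)
    have hb' : ∀ j ∈ s, ‖b j‖ ≤ δ := fun j hj => hb j (mem_insert_of_mem hj)
    have hai : ‖a i‖ ≤ α := ha i (mem_insert_self _ _)
    have hbi : ‖b i‖ ≤ δ := hb i (mem_insert_self _ _)
    rw [prod_insert hi, prod_insert hi, card_insert_of_notMem hi, Nat.add_sub_cancel]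
    have hsplit : (a i + b i) * ∏ j ∈ s, (a j + b j) - a i * ∏ j ∈ s, a j =
        a i * (∏ j ∈ s, (a j + b j) - ∏ j ∈ s, a j) + b i * ∏ j ∈ s, (a j + b j) := by ring
    rw [hsplit]
    have hP : ‖∏ j ∈ s, (a j + b j)‖ ≤ (α + δ) ^ s.card := by
      refine (Finset.norm_prod_le _ _).trans ?_
      rw [← prod_const]
      exact prod_le_prod (fun _ _ => norm_nonneg _) fun j hj =>
        (norm_add_le _ _).trans (add_le_add (ha' j hj) (hb' j hj))
    have hαδ : α ≤ α + δ := le_add_of_nonneg_right hδ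
    calc ‖a i * (∏ j ∈ s, (a j + b j) - ∏ j ∈ s, a j) + b i * ∏ j ∈ s, (a j + b j)‖
        ≤ ‖a i‖ * ‖∏ j ∈ s, (a j + b j) - ∏ j ∈ s, a j‖ + ‖b i‖ * ‖∏ j ∈ s, (a j + b j)‖ := by
          refine (norm_add_le _ _).trans ?_
          rw [norm_mul, norm_mul]
      _ ≤ α * (s.card * δ * (α + δ) ^ (s.card - 1)) + δ * (α + δ) ^ s.card :=
          add_le_add (mul_le_mul hai (ih ha' hb') (norm_nonneg _) hα)
            (mul_le_mul hbi hP (norm_nonneg _) hδ)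
      _ ≤ (α + δ) * (s.card * δ * (α + δ) ^ (s.card - 1)) + δ * (α + δ) ^ s.card := by
          gcongr
      _ ≤ (s.card + 1 : ℕ) * δ * (α + δ) ^ s.card := by
          rcases Nat.eq_zero_or_pos s.card with h0 | hpos
          · simp [h0]
          · have hpow : (α + δ) ^ s.card = (α + δ) * (α + δ) ^ (s.card - 1) := by
              rw [← pow_succ', Nat.sub_add_cancel hpos]
            rw [hpow]; push_cast; exact le_of_eq (by ring)

/-! ## Costs and the doubled weight -/

variable {d L : ℕ} [NeZero L] {N : ℕ} {G : Type*} [Group G] [TopologicalSpace G]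
  [IsTopologicalGroup G] [CompactSpace G] [MeasurableSpace G] [BorelSpace G]
  [SecondCountableTopology G] (ρ : G →* Matrix (Fin N) (Fin N) ℂ)

/-- The plaquette cost `N - Re tr ρ(V_q)` on the torus. -/
def cost (q : Plaquette d L) (V : GaugeConfig d L G) : ℝ := (N : ℝ) - WilsonRP.plaqRe ρ V q

omit [NeZero L] [MeasurableSpace G] [BorelSpace G] [SecondCountableTopology G] in
/-- `|cost| ≤ 2N`. -/
theorem abs_cost_le (hρ : Continuous ρ) (q : Plaquette d L) (V : GaugeConfig d L G) :
    |cost ρ q V| ≤ 2 * N := by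
  have := WilsonRP.abs_plaqRe_le ρ hρ V q
  unfold cost
  rw [abs_le] at this ⊢
  constructor <;> linarith [this.1, this.2]

omit [NeZero L] [MeasurableSpace G] [BorelSpace G] [SecondCountableTopology G] [CompactSpace G] in
/-- The cost is continuous. -/
theorem continuous_cost (hρ : Continuous ρ) (q : Plaquette d L) :
    Continuous (cost (G := G) ρ q) :=
  continuous_const.sub (continuous_plaqRe ρ hρ q)

omit [NeZero L] [MeasurableSpace G] [BorelSpace G] [SecondCountableTopology G] [TopologicalSpace G]
  [IsTopologicalGroup G] [CompactSpace G] in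
/-- The doubled weight through the doubled cost: `tdweight = e^{-z(cost V + cost V')} - 1`. -/
theorem tdweight_eq_exp (z : ℂ) (q : Plaquette d L) (p : GaugeConfig d L G × GaugeConfig d L G) :
    tdweight ρ z q p = Complex.exp (-(z * ((cost ρ q p.1 + cost ρ q p.2 : ℝ) : ℂ))) - 1 := by
  simp only [tdweight, tweight, cost, add_sub_cancel, Complex.ofReal_add]
  rw [← Complex.exp_add]
  ring_nf

/-! ## The jet coefficient -/

/-- THE JET COEFFICIENT: the real doubled moment
`∫ (f V - f V')(g V - g V') ∏_{q ∈ Q} (-(cost_q V + cost_q V')) d(π ⊗ π)`. -/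
def jetCoeff (f g : GaugeConfig d L G → ℝ) (Q : Finset (Plaquette d L)) : ℝ :=
  ∫ p, (f p.1 - f p.2) * (g p.1 - g p.2) * ∏ q ∈ Q, (-(cost ρ q p.1 + cost ρ q p.2))
    ∂(Measure.pi fun _ : Edge d L => haarProbability G).prod
      (Measure.pi fun _ : Edge d L => haarProbability G)

/-- ★★ **THE LEADING JET OF A REPLICA CLUSTER INTEGRAL**:
`replicaTerm f g Q z - jetCoeff f g Q · z^{#Q} = O(z^{#Q+1})` at `z = 0`. -/
theorem replicaTerm_jet (hρ : Continuous ρ) {f g : GaugeConfig d L G → ℝ} (hfm : Measurable f)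
    (hgm : Measurable g) {Cf Cg : ℝ} (hfb : ∀ U, |f U| ≤ Cf) (hgb : ∀ U, |g U| ≤ Cg)
    (Q : Finset (Plaquette d L)) :
    (fun z => replicaTerm ρ f g Q z - (jetCoeff ρ f g Q : ℂ) * z ^ Q.card) =O[𝓝 (0 : ℂ)]
      fun z => z ^ (Q.card + 1) := by
  classical
  set μ := (Measure.pi fun _ : Edge d L => haarProbability G).prod
    (Measure.pi fun _ : Edge d L => haarProbability G) with hμ
  haveI : IsProbabilityMeasure μ := by rw [hμ]; infer_instance
  set S : ℝ := 4 * N with hS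
  have hS0 : 0 ≤ S := by rw [hS]; positivity
  have hCf : 0 ≤ Cf := (abs_nonneg _).trans (hfb 1)
  have hCg : 0 ≤ Cg := (abs_nonneg _).trans (hgb 1)
  set n := Q.card with hn
  -- the doubled costs `σ_q`
  have hσ : ∀ (q : Plaquette d L) (p : GaugeConfig d L G × GaugeConfig d L G),
      |cost ρ q p.1 + cost ρ q p.2| ≤ S := fun q p => by
    rw [hS]
    have h1 := abs_cost_le ρ hρ q p.1
    have h2 := abs_cost_le ρ hρ q p.2
    exact (abs_add_le _ _).trans (by linarith)
  -- the pointwise bound, for `S ‖z‖ ≤ 1`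
  set C : ℝ := 4 * Cf * Cg * (n * S ^ 2 * (2 * S) ^ (n - 1)) with hC
  have key : ∀ z : ℂ, S * ‖z‖ ≤ 1 → ∀ p : GaugeConfig d L G × GaugeConfig d L G,
      ‖replicaIntegrand ρ f g Q z p -
        (((f p.1 - f p.2) * (g p.1 - g p.2) * ∏ q ∈ Q, (-(cost ρ q p.1 + cost ρ q p.2)) : ℝ) : ℂ) *
          z ^ n‖ ≤ C * ‖z‖ ^ (n + 1) := by
    intro z hz p
    -- `a_q = -z σ_q`, `b_q = e^{a_q} - 1 - a_q`
    set a : Plaquette d L → ℂ := fun q => -(z * ((cost ρ q p.1 + cost ρ q p.2 : ℝ) : ℂ)) with ha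
    set b : Plaquette d L → ℂ := fun q => Complex.exp (a q) - 1 - a q with hb
    have hab : ∀ q, tdweight ρ z q p = a q + b q := fun q => by
      rw [tdweight_eq_exp]; simp [ha, hb]
    have haq : ∀ q ∈ Q, ‖a q‖ ≤ S * ‖z‖ := fun q _ => by
      simp only [ha, norm_neg, norm_mul, Complex.norm_real, Real.norm_eq_abs]
      nlinarith [hσ q p, norm_nonneg z, abs_nonneg (cost ρ q p.1 + cost ρ q p.2)]
    have hbq : ∀ q ∈ Q, ‖b q‖ ≤ (S * ‖z‖) ^ 2 := fun q hq => by
      have h1 : ‖a q‖ ≤ 1 := (haq q hq).trans hz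
      calc ‖b q‖ ≤ ‖a q‖ ^ 2 := Complex.norm_exp_sub_one_sub_id_le h1
        _ ≤ (S * ‖z‖) ^ 2 := by gcongr; exact haq q hq
    have hprod : ∏ q ∈ Q, tdweight ρ z q p = ∏ q ∈ Q, (a q + b q) := prod_congr rfl fun q _ => hab q
    have haprod : ∏ q ∈ Q, a q =
        (((∏ q ∈ Q, (-(cost ρ q p.1 + cost ρ q p.2)) : ℝ) : ℂ)) * z ^ n := by
      rw [Complex.ofReal_prod, hn, ← prod_const, ← prod_mul_distrib]
      refine prod_congr rfl fun q _ => ?_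
      simp [ha]; ring
    have hpert := norm_prod_add_sub_prod_le Q (by positivity) (by positivity) haq hbq
    -- assemble
    have hfg : ‖(((f p.1 : ℝ) : ℂ) - f p.2) * (((g p.1 : ℝ) : ℂ) - g p.2)‖ ≤ 4 * Cf * Cg := by
      rw [norm_mul]
      have e1 : ‖((f p.1 : ℝ) : ℂ) - f p.2‖ ≤ 2 * Cf := by
        rw [← Complex.ofReal_sub, Complex.norm_real, Real.norm_eq_abs]
        exact (abs_sub _ _).trans (by linarith [hfb p.1, hfb p.2])
      have e2 : ‖((g p.1 : ℝ) : ℂ) - g p.2‖ ≤ 2 * Cg := by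
        rw [← Complex.ofReal_sub, Complex.norm_real, Real.norm_eq_abs]
        exact (abs_sub _ _).trans (by linarith [hgb p.1, hgb p.2])
      nlinarith [norm_nonneg (((f p.1 : ℝ) : ℂ) - f p.2), norm_nonneg (((g p.1 : ℝ) : ℂ) - g p.2)]
    have hexpr : replicaIntegrand ρ f g Q z p -
        (((f p.1 - f p.2) * (g p.1 - g p.2) * ∏ q ∈ Q, (-(cost ρ q p.1 + cost ρ q p.2)) : ℝ) : ℂ) *
          z ^ n =
        ((((f p.1 : ℝ) : ℂ) - f p.2) * (((g p.1 : ℝ) : ℂ) - g p.2)) *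
          (∏ q ∈ Q, (a q + b q) - ∏ q ∈ Q, a q) := by
      rw [replicaIntegrand, hprod, haprod]
      push_cast
      ring
    rw [hexpr, norm_mul]
    calc ‖(((f p.1 : ℝ) : ℂ) - f p.2) * (((g p.1 : ℝ) : ℂ) - g p.2)‖ *
          ‖∏ q ∈ Q, (a q + b q) - ∏ q ∈ Q, a q‖
        ≤ (4 * Cf * Cg) * (n * (S * ‖z‖) ^ 2 * (S * ‖z‖ + (S * ‖z‖) ^ 2) ^ (n - 1)) := by
          gcongr
      _ ≤ (4 * Cf * Cg) * (n * (S * ‖z‖) ^ 2 * (2 * S * ‖z‖) ^ (n - 1)) := by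
          gcongr
          · nlinarith [norm_nonneg z, hS0, hz, mul_nonneg hS0 (norm_nonneg z)]
      _ = C * ‖z‖ ^ (n + 1) := by
          rw [hC]
          rcases Nat.eq_zero_or_pos n with h0 | hpos
          · simp [h0]
          · have hz2 : ‖z‖ ^ 2 * ‖z‖ ^ (n - 1) = ‖z‖ ^ (n + 1) := by
              rw [← pow_add]; congr 1; omega
            rw [show (2 * S * ‖z‖) = (2 * S) * ‖z‖ by ring, mul_pow (2 * S) ‖z‖, mul_pow S ‖z‖, ← hz2]
            ring
  -- integrate
  have hmeas : ∀ z, Integrable (replicaIntegrand ρ f g Q z) μ := fun z => by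
    refine Integrable.of_bound (measurable_replicaIntegrand ρ hρ hfm hgm Q z).aestronglyMeasurable
      (4 * Cf * Cg * (Real.exp (2 * N * ‖z‖) + 1) ^ (2 * n)) (ae_of_all _ fun p => ?_)
    unfold replicaIntegrand
    rw [norm_mul, norm_mul]
    have e1 : ‖((f p.1 : ℝ) : ℂ) - f p.2‖ ≤ 2 * Cf := by
      rw [← Complex.ofReal_sub, Complex.norm_real, Real.norm_eq_abs]
      exact (abs_sub _ _).trans (by linarith [hfb p.1, hfb p.2])
    have e2 : ‖((g p.1 : ℝ) : ℂ) - g p.2‖ ≤ 2 * Cg := by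
      rw [← Complex.ofReal_sub, Complex.norm_real, Real.norm_eq_abs]
      exact (abs_sub _ _).trans (by linarith [hgb p.1, hgb p.2])
    have e3 : ‖∏ q ∈ Q, tdweight ρ z q p‖ ≤ (Real.exp (2 * N * ‖z‖) + 1) ^ (2 * n) := by
      refine (Finset.norm_prod_le _ _).trans ?_
      rw [hn, pow_mul, ← prod_const]
      refine prod_le_prod (fun _ _ => norm_nonneg _) fun q _ => ?_
      set E := Real.exp (2 * N * ‖z‖) with hE
      have hE0 : 0 ≤ E := (Real.exp_pos _).le
      have hone : ∀ V : GaugeConfig d L G, ‖1 + tweight ρ z q V‖ ≤ E := fun V => by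
        have h : 1 + tweight ρ z q V =
            Complex.exp (-(z * (((N : ℝ) - WilsonRP.plaqRe ρ V q : ℝ) : ℂ))) := by
          simp [tweight]
        rw [h, Complex.norm_exp, hE]
        refine Real.exp_le_exp.2 ((Complex.re_le_norm _).trans ?_)
        rw [norm_neg, norm_mul, Complex.norm_real, Real.norm_eq_abs]
        have h2 : |(N : ℝ) - WilsonRP.plaqRe ρ V q| ≤ 2 * N := abs_cost_le ρ hρ q V
        nlinarith [norm_nonneg z]
      unfold tdweight
      calc ‖(1 + tweight ρ z q p.1) * (1 + tweight ρ z q p.2) - 1‖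
          ≤ ‖1 + tweight ρ z q p.1‖ * ‖1 + tweight ρ z q p.2‖ + 1 := by
            refine (norm_sub_le _ _).trans ?_; rw [norm_mul, norm_one]
        _ ≤ E * E + 1 := by gcongr <;> exact hone _
        _ ≤ (E + 1) ^ 2 := by nlinarith
    calc ‖((f p.1 : ℝ) : ℂ) - f p.2‖ * ‖((g p.1 : ℝ) : ℂ) - g p.2‖ * ‖∏ q ∈ Q, tdweight ρ z q p‖
        ≤ 2 * Cf * (2 * Cg) * (Real.exp (2 * N * ‖z‖) + 1) ^ (2 * n) := by gcongr
      _ = 4 * Cf * Cg * (Real.exp (2 * N * ‖z‖) + 1) ^ (2 * n) := by ring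
  have hreal_meas : Measurable fun p : GaugeConfig d L G × GaugeConfig d L G =>
      (f p.1 - f p.2) * (g p.1 - g p.2) * ∏ q ∈ Q, (-(cost ρ q p.1 + cost ρ q p.2)) := by
    refine (((hfm.comp measurable_fst).sub (hfm.comp measurable_snd)).mul
      ((hgm.comp measurable_fst).sub (hgm.comp measurable_snd))).mul ?_
    refine Finset.measurable_prod _ fun q _ => ?_
    exact (((continuous_cost ρ hρ q).measurable.comp measurable_fst).add
      ((continuous_cost ρ hρ q).measurable.comp measurable_snd)).neg
  have hreal_bd : ∀ p : GaugeConfig d L G × GaugeConfig d L G,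
      ‖(f p.1 - f p.2) * (g p.1 - g p.2) * ∏ q ∈ Q, (-(cost ρ q p.1 + cost ρ q p.2))‖ ≤
        4 * Cf * Cg * S ^ n := fun p => by
    rw [norm_mul, norm_mul, Real.norm_eq_abs, Real.norm_eq_abs, norm_prod]
    have e1 : |f p.1 - f p.2| ≤ 2 * Cf := (abs_sub _ _).trans (by linarith [hfb p.1, hfb p.2])
    have e2 : |g p.1 - g p.2| ≤ 2 * Cg := (abs_sub _ _).trans (by linarith [hgb p.1, hgb p.2])
    have e3 : ∏ q ∈ Q, ‖-(cost ρ q p.1 + cost ρ q p.2)‖ ≤ S ^ n := by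
      rw [hn, ← prod_const]
      exact prod_le_prod (fun _ _ => norm_nonneg _) fun q _ => by
        rw [norm_neg, Real.norm_eq_abs]; exact hσ q p
    calc |f p.1 - f p.2| * |g p.1 - g p.2| * ∏ q ∈ Q, ‖-(cost ρ q p.1 + cost ρ q p.2)‖
        ≤ 2 * Cf * (2 * Cg) * S ^ n := by gcongr
      _ = 4 * Cf * Cg * S ^ n := by ring
  have hreal_int : Integrable (fun p : GaugeConfig d L G × GaugeConfig d L G =>
      (f p.1 - f p.2) * (g p.1 - g p.2) * ∏ q ∈ Q, (-(cost ρ q p.1 + cost ρ q p.2))) μ :=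
    Integrable.of_bound hreal_meas.aestronglyMeasurable _ (ae_of_all _ hreal_bd)
  -- the `O`-bound near `0`
  refine IsBigO.of_bound C ?_
  have hball : {z : ℂ | S * ‖z‖ ≤ 1} ∈ 𝓝 (0 : ℂ) := by
    rcases eq_or_lt_of_le hS0 with h0 | hpos
    · exact Filter.Eventually.of_forall fun z => by simp [← h0]
    · have : Metric.closedBall (0 : ℂ) (1 / S) ⊆ {z : ℂ | S * ‖z‖ ≤ 1} := fun z hz => by
        rw [Metric.mem_closedBall, dist_zero_right] at hz
        show S * ‖z‖ ≤ 1
        rw [le_div_iff₀ hpos] at hz; linarith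
      exact Filter.mem_of_superset (Metric.closedBall_mem_nhds 0 (by positivity)) this
  filter_upwards [hball] with z hz
  rw [replicaTerm_eq_integral_prod ρ hρ hfm hgm Q z, ← hμ, jetCoeff, ← hμ]
  have hcoeff : ((∫ p, (f p.1 - f p.2) * (g p.1 - g p.2) * ∏ q ∈ Q, (-(cost ρ q p.1 + cost ρ q p.2)) ∂μ
      : ℝ) : ℂ) * z ^ n = ∫ p, (((f p.1 - f p.2) * (g p.1 - g p.2) *
        ∏ q ∈ Q, (-(cost ρ q p.1 + cost ρ q p.2)) : ℝ) : ℂ) * z ^ n ∂μ := by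
    rw [integral_mul_const, integral_complex_ofReal]
  have hint2 : Integrable (fun p : GaugeConfig d L G × GaugeConfig d L G =>
      (((f p.1 - f p.2) * (g p.1 - g p.2) * ∏ q ∈ Q, (-(cost ρ q p.1 + cost ρ q p.2)) : ℝ) : ℂ) *
        z ^ n) μ := (hreal_int.ofReal).mul_const _
  rw [hcoeff, ← integral_sub (hmeas z) hint2]
  refine (norm_integral_le_integral_norm _).trans ?_
  refine (integral_mono_of_nonneg (ae_of_all _ fun _ => norm_nonneg _) (integrable_const _)
    (ae_of_all _ fun p => key z hz p)).trans ?_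
  rw [integral_const, smul_eq_mul, probReal_univ, one_mul, norm_pow]

end DiagRPUnif

end

end Summit.QuantumFields.GaugeBoot
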